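import Mathlib
import HarnessLib
import Summits.ValiantsHypothesis.ValiantsHypothesis.Theorems.LacunarySymmetroidMatrixDescartesOsculationLawTwoKCusp

/-!
# ValiantsHypothesis / LacunarySymmetroid — crux `MatrixDescartes` (stmt-ValiantsHypothesis-18050, V1),
# line `Cruxes/MatrixDescartes/Lines/osculation_law.lean` («osculation-law»): the MONIC CUBIC cusp curve
# `b³ + σ₁·b² + σ₂·b + σ₃ = 0` — θ-calculus and the two reduction identities

For the block splitting `(r, s) = (3, 0)` of the `m = 3` rung of the line's law, the insertion polynomial is a
MONIC CUBIC in `b`: `Φ = det(G(t) + b·I₃) = b³ + σ₁(t)·b² + σ₂(t)·b + σ₃(t)` (`σ₁ = tr G`, `σ₂` = the sum of the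
principal `2 × 2` minors, `σ₃ = det G`).  This file (1/4 of the `(3,0)` piece; no definitions, no named facts,
Mathlib + the `m = 2` files only) supplies the algebra for ARBITRARY `σ₁ σ₂ σ₃ : ℝ[X]`:

* `eval_Phi3`, `eval_logHessian_Phi3` — θ-calculus for `Φ = X₁³ + X₁²·ι σ₁ + X₁·ι σ₂ + ι σ₃` (`ι : X ↦ X₀`): the
  bordered log-Hessian `H(Φ)` of the line, evaluated at `(t, b)`, in the nine scalars `σᵢ(t)`, `θσᵢ(t)`, `θ²σᵢ(t)`
  (`θ = t·d/dt`);
* `hess_reduce3` (one `ring`): **`H = Q·Φ + R₂·b² + R₁·b + R₀`**, the reduction of the Hessian (32 monomials,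
  `b`-degree 8) modulo the monic cubic, with `Q` (59 monomials) and the remainder coefficients `R₂, R₁, R₀` (34, 35,
  23 monomials; isobaric of weights 7, 8, 9 for `wt(σᵢ) = i`) written out — computed by exact polynomial division in the
  seat and CHECKED HERE by the kernel;
* `eval_R2`, `eval_R1`, `eval_R0`, `hess_reduce_poly3` — the same with `R₂, R₁, R₀` as honest polynomials in `ℝ[X]`:
  on the curve, `H(Φ)(t,b) = 0 ↔ R₂(t)·b² + R₁(t)·b + R₀(t) = 0`;
* `euclid_step3` (one `ring`): the SECOND Euclid step `R₂²·Φ = (R₂ b + σ₁R₂ − R₁)·R + (L₁ b + L₀)` with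
  `L₁ = σ₂R₂² − R₀R₂ − σ₁R₁R₂ + R₁²`, `L₀ = σ₃R₂² − σ₁R₀R₂ + R₀R₁`, and `resultant_step3`/`resultant_step3_lin`: on the
  curve `N(t) = L₁²·R(t,b)` resp. (when `R₂ ≡ 0`) `N′(t) = R₁³·Φ(t,b)`.

The COUNT of the osculation set of the cubic curve (the analogue of `OsculationCusp.cusp_curve_ncard_le`) and the
`(3,K)` pencil instantiation are the sibling files `…OsculationLawCuspCubicCount`, `…CuspCubicSupport`,
`…OsculationLawThreeKThreeZero`.  Honest framing: helper algebra for a located rung of an UNREGISTERED V1 law line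
(ideator val-idea-2); `OsculationLaw` (all `m`), `PeelInequality`, `MatrixDescartes`, Conjecture B and `VP ≠ VNP`
are OPEN / NOT proved; nothing here is progress on them.
-/

-- `Summit.ValiantsHypothesis.ValiantsHypothesis.…` is the tree's mandated single-conjunct layout (Sub = Summit).
set_option linter.dupNamespace false

noncomputable section

namespace Summit.ValiantsHypothesis.ValiantsHypothesis.Theorems.LacunarySymmetroidMatrixDescartes

open Polynomial Set
open scoped BigOperators

namespace OsculationCuspCubic

/-! ### θ-calculus for `Φ = X₁³ + X₁²·ι σ₁ + X₁·ι σ₂ + ι σ₃` -/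

/-- `Φ(t,b) = b³ + σ₁(t)·b² + σ₂(t)·b + σ₃(t)`. [folklore] -/
theorem eval_Phi3 (σ₁ σ₂ σ₃ : ℝ[X]) (p : Fin 2 → ℝ) :
    MvPolynomial.eval p (MvPolynomial.X 1 * MvPolynomial.X 1 * MvPolynomial.X 1 + MvPolynomial.X 1 * MvPolynomial.X 1 * Polynomial.aeval (MvPolynomial.X 0 : MvPolynomial (Fin 2) ℝ) σ₁ + MvPolynomial.X 1 * Polynomial.aeval (MvPolynomial.X 0 : MvPolynomial (Fin 2) ℝ) σ₂ + Polynomial.aeval (MvPolynomial.X 0 : MvPolynomial (Fin 2) ℝ) σ₃) =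
      p 1 ^ 3 + p 1 ^ 2 * σ₁.eval (p 0) + p 1 * σ₂.eval (p 0) + σ₃.eval (p 0) := by
  simp only [map_add, map_mul, MvPolynomial.eval_X, OsculationRankOne.eval_aevalX0]
  ring

/-- The bordered log-Hessian of `Φ = X₁³ + X₁²·ι σ₁ + X₁·ι σ₂ + ι σ₃` at `p = (t,b)`, in the scalars
`σᵢ(t)`, `θσᵢ(t) = t σᵢ'(t)`, `θ²σᵢ(t) = t σᵢ'(t) + t² σᵢ''(t)`. [folklore] -/
theorem eval_logHessian_Phi3 (σ₁ σ₂ σ₃ : ℝ[X]) (Φ : MvPolynomial (Fin 2) ℝ) (hΦ : Φ = (MvPolynomial.X 1 * MvPolynomial.X 1 * MvPolynomial.X 1 + MvPolynomial.X 1 * MvPolynomial.X 1 * Polynomial.aeval (MvPolynomial.X 0 : MvPolynomial (Fin 2) ℝ) σ₁ + MvPolynomial.X 1 * Polynomial.aeval (MvPolynomial.X 0 : MvPolynomial (Fin 2) ℝ) σ₂ + Polynomial.aeval (MvPolynomial.X 0 : MvPolynomial (Fin 2) ℝ) σ₃))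
    (p : Fin 2 → ℝ) :
    MvPolynomial.eval p
        (MvPolynomial.X 0 * MvPolynomial.pderiv 0 (MvPolynomial.X 0 * MvPolynomial.pderiv 0 Φ)
            * (MvPolynomial.X 1 * MvPolynomial.pderiv 1 Φ) ^ 2
          - 2 * (MvPolynomial.X 0 * MvPolynomial.pderiv 0 (MvPolynomial.X 1 * MvPolynomial.pderiv 1 Φ))
            * (MvPolynomial.X 0 * MvPolynomial.pderiv 0 Φ) * (MvPolynomial.X 1 * MvPolynomial.pderiv 1 Φ)
          + MvPolynomial.X 1 * MvPolynomial.pderiv 1 (MvPolynomial.X 1 * MvPolynomial.pderiv 1 Φ)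
            * (MvPolynomial.X 0 * MvPolynomial.pderiv 0 Φ) ^ 2) =
      (((p 0) * (derivative σ₁).eval (p 0) + (p 0) ^ 2 * (derivative (derivative σ₁)).eval (p 0)) * (p 1) ^ 2 + ((p 0) * (derivative σ₂).eval (p 0) + (p 0) ^ 2 * (derivative (derivative σ₂)).eval (p 0)) * (p 1)
          + ((p 0) * (derivative σ₃).eval (p 0) + (p 0) ^ 2 * (derivative (derivative σ₃)).eval (p 0))) * (3 * (p 1) ^ 3 + 2 * σ₁.eval (p 0) * (p 1) ^ 2
          + σ₂.eval (p 0) * (p 1)) ^ 2 - 2 * (2 * ((p 0) * (derivative σ₁).eval (p 0)) * (p 1) ^ 2 + ((p 0) * (derivative σ₂).eval (p 0)) * (p 1)) * (((p 0) * (derivative σ₁).eval (p 0)) * (p 1) ^ 2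
          + ((p 0) * (derivative σ₂).eval (p 0)) * (p 1) + ((p 0) * (derivative σ₃).eval (p 0))) * (3 * (p 1) ^ 3 + 2 * σ₁.eval (p 0) * (p 1) ^ 2 + σ₂.eval (p 0) * (p 1))
          + (9 * (p 1) ^ 3 + 4 * σ₁.eval (p 0) * (p 1) ^ 2 + σ₂.eval (p 0) * (p 1)) * (((p 0) * (derivative σ₁).eval (p 0)) * (p 1) ^ 2 + ((p 0) * (derivative σ₂).eval (p 0)) * (p 1)
          + ((p 0) * (derivative σ₃).eval (p 0))) ^ 2 := by
  subst hΦ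
  simp only [map_add, map_sub, map_mul, map_pow, MvPolynomial.pderiv_mul,
    MvPolynomial.pderiv_X_self, MvPolynomial.pderiv_X_of_ne (show (1 : Fin 2) ≠ 0 by decide),
    OsculationRankOne.pderiv_zero_aevalX0, OsculationRankOne.pderiv_one_aevalX0,
    MvPolynomial.eval_X, OsculationRankOne.eval_aevalX0, map_ofNat, map_one, mul_zero, zero_mul, add_zero,
    zero_add, one_mul, mul_one]
  ring

/-! ### Reduction of the Hessian modulo the monic cubic -/

set_option maxHeartbeats 8000000 in
/-- **`H = Q·Φ + R₂ b² + R₁ b + R₀`** for the monic cubic (exact division by `b³ + S₁b² + S₂b + S₃`, performed in the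
seat by exact rational polynomial arithmetic; `Tᵢ = θσᵢ`, `Uᵢ = θ²σᵢ`; one `ring`). [folklore] -/
theorem hess_reduce3 (b S₁ S₂ S₃ T₁ T₂ T₃ U₁ U₂ U₃ : ℝ) :
    (U₁ * b ^ 2 + U₂ * b + U₃) * (3 * b ^ 3 + 2 * S₁ * b ^ 2 + S₂ * b) ^ 2 - 2 * (2 * T₁ * b ^ 2 + T₂ * b) * (T₁ * b ^ 2 + T₂ * b + T₃) * (3 * b ^ 3 + 2 * S₁ * b ^ 2
          + S₂ * b) + (9 * b ^ 3 + 4 * S₁ * b ^ 2 + S₂ * b) * (T₁ * b ^ 2 + T₂ * b + T₃) ^ 2 =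
      (9 * b ^ 5 * U₁ + 3 * b ^ 4 * S₁ * U₁ - 3 * b ^ 4 * T₁ ^ 2 + 9 * b ^ 4 * U₂ + b ^ 3 * S₁ ^ 2 * U₁ - b ^ 3 * S₁ * T₁ ^ 2 + 3 * b ^ 3 * S₁ * U₂ - 3 * b ^ 3 * S₂ * U₁
          + 9 * b ^ 3 * U₃ - b ^ 2 * S₁ ^ 3 * U₁ + b ^ 2 * S₁ ^ 2 * T₁ ^ 2 + b ^ 2 * S₁ ^ 2 * U₂ + 4 * b ^ 2 * S₁ * S₂ * U₁ - 4 * b ^ 2 * S₁ * T₁ * T₂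
          + 3 * b ^ 2 * S₁ * U₃ - 3 * b ^ 2 * S₂ * U₂ - 9 * b ^ 2 * S₃ * U₁ + 6 * b ^ 2 * T₁ * T₃ + 3 * b ^ 2 * T₂ ^ 2 + b * S₁ ^ 4 * U₁ - b * S₁ ^ 3 * T₁ ^ 2
          - b * S₁ ^ 3 * U₂ - 5 * b * S₁ ^ 2 * S₂ * U₁ + 4 * b * S₁ ^ 2 * T₁ * T₂ + b * S₁ ^ 2 * U₃ + b * S₁ * S₂ * T₁ ^ 2 + 4 * b * S₁ * S₂ * U₂ + 6 * b * S₁ * S₃ * U₁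
          - 6 * b * S₁ * T₁ * T₃ - 3 * b * S₁ * T₂ ^ 2 + 4 * b * S₂ ^ 2 * U₁ - 4 * b * S₂ * T₁ * T₂ - 3 * b * S₂ * U₃ + 3 * b * S₃ * T₁ ^ 2 - 9 * b * S₃ * U₂
          + 12 * b * T₂ * T₃ - S₁ ^ 5 * U₁ + S₁ ^ 4 * T₁ ^ 2 + S₁ ^ 4 * U₂ + 6 * S₁ ^ 3 * S₂ * U₁ - 4 * S₁ ^ 3 * T₁ * T₂ - S₁ ^ 3 * U₃ - 2 * S₁ ^ 2 * S₂ * T₁ ^ 2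
          - 5 * S₁ ^ 2 * S₂ * U₂ - 7 * S₁ ^ 2 * S₃ * U₁ + 6 * S₁ ^ 2 * T₁ * T₃ + 3 * S₁ ^ 2 * T₂ ^ 2 - 8 * S₁ * S₂ ^ 2 * U₁ + 8 * S₁ * S₂ * T₁ * T₂ + 4 * S₁ * S₂ * U₃
          - 2 * S₁ * S₃ * T₁ ^ 2 + 6 * S₁ * S₃ * U₂ - 8 * S₁ * T₂ * T₃ + 4 * S₂ ^ 2 * U₂ + 12 * S₂ * S₃ * U₁ - 8 * S₂ * T₁ * T₃ - 4 * S₂ * T₂ ^ 2 - 9 * S₃ * U₃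
          + 9 * T₃ ^ 2) * (b ^ 3 + S₁ * b ^ 2 + S₂ * b + S₃)
        + (S₁ ^ 6 * U₁ - S₁ ^ 5 * T₁ ^ 2 - S₁ ^ 5 * U₂ - 7 * S₁ ^ 4 * S₂ * U₁ + 4 * S₁ ^ 4 * T₁ * T₂ + S₁ ^ 4 * U₃ + 3 * S₁ ^ 3 * S₂ * T₁ ^ 2 + 6 * S₁ ^ 3 * S₂ * U₂
          + 8 * S₁ ^ 3 * S₃ * U₁ - 6 * S₁ ^ 3 * T₁ * T₃ - 3 * S₁ ^ 3 * T₂ ^ 2 + 13 * S₁ ^ 2 * S₂ ^ 2 * U₁ - 12 * S₁ ^ 2 * S₂ * T₁ * T₂ - 5 * S₁ ^ 2 * S₂ * U₃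
          + S₁ ^ 2 * S₃ * T₁ ^ 2 - 7 * S₁ ^ 2 * S₃ * U₂ + 8 * S₁ ^ 2 * T₂ * T₃ - S₁ * S₂ ^ 2 * T₁ ^ 2 - 8 * S₁ * S₂ ^ 2 * U₂ - 22 * S₁ * S₂ * S₃ * U₁
          + 14 * S₁ * S₂ * T₁ * T₃ + 7 * S₁ * S₂ * T₂ ^ 2 + 4 * S₁ * S₃ * T₁ * T₂ + 6 * S₁ * S₃ * U₃ - 5 * S₁ * T₃ ^ 2 - 4 * S₂ ^ 3 * U₁ + 4 * S₂ ^ 2 * T₁ * T₂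
          + 4 * S₂ ^ 2 * U₃ - 3 * S₂ * S₃ * T₁ ^ 2 + 12 * S₂ * S₃ * U₂ - 12 * S₂ * T₂ * T₃ + 9 * S₃ ^ 2 * U₁ - 6 * S₃ * T₁ * T₃ - 3 * S₃ * T₂ ^ 2) * b ^ 2
        + (S₁ ^ 5 * S₂ * U₁ - S₁ ^ 4 * S₂ * T₁ ^ 2 - S₁ ^ 4 * S₂ * U₂ - S₁ ^ 4 * S₃ * U₁ - 6 * S₁ ^ 3 * S₂ ^ 2 * U₁ + 4 * S₁ ^ 3 * S₂ * T₁ * T₂ + S₁ ^ 3 * S₂ * U₃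
          + S₁ ^ 3 * S₃ * T₁ ^ 2 + S₁ ^ 3 * S₃ * U₂ + 2 * S₁ ^ 2 * S₂ ^ 2 * T₁ ^ 2 + 5 * S₁ ^ 2 * S₂ ^ 2 * U₂ + 12 * S₁ ^ 2 * S₂ * S₃ * U₁ - 6 * S₁ ^ 2 * S₂ * T₁ * T₃
          - 3 * S₁ ^ 2 * S₂ * T₂ ^ 2 - 4 * S₁ ^ 2 * S₃ * T₁ * T₂ - S₁ ^ 2 * S₃ * U₃ + 8 * S₁ * S₂ ^ 3 * U₁ - 8 * S₁ * S₂ ^ 2 * T₁ * T₂ - 4 * S₁ * S₂ ^ 2 * U₃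
          + S₁ * S₂ * S₃ * T₁ ^ 2 - 10 * S₁ * S₂ * S₃ * U₂ + 8 * S₁ * S₂ * T₂ * T₃ - 6 * S₁ * S₃ ^ 2 * U₁ + 6 * S₁ * S₃ * T₁ * T₃ + 3 * S₁ * S₃ * T₂ ^ 2
          - 4 * S₂ ^ 3 * U₂ - 16 * S₂ ^ 2 * S₃ * U₁ + 8 * S₂ ^ 2 * T₁ * T₃ + 4 * S₂ ^ 2 * T₂ ^ 2 + 4 * S₂ * S₃ * T₁ * T₂ + 12 * S₂ * S₃ * U₃ - 8 * S₂ * T₃ ^ 2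
          - 3 * S₃ ^ 2 * T₁ ^ 2 + 9 * S₃ ^ 2 * U₂ - 12 * S₃ * T₂ * T₃) * b
        + (S₁ ^ 5 * S₃ * U₁ - S₁ ^ 4 * S₃ * T₁ ^ 2 - S₁ ^ 4 * S₃ * U₂ - 6 * S₁ ^ 3 * S₂ * S₃ * U₁ + 4 * S₁ ^ 3 * S₃ * T₁ * T₂ + S₁ ^ 3 * S₃ * U₃ + 2 * S₁ ^ 2 * S₂ * S₃ * T₁ ^ 2
          + 5 * S₁ ^ 2 * S₂ * S₃ * U₂ + 7 * S₁ ^ 2 * S₃ ^ 2 * U₁ - 6 * S₁ ^ 2 * S₃ * T₁ * T₃ - 3 * S₁ ^ 2 * S₃ * T₂ ^ 2 + 8 * S₁ * S₂ ^ 2 * S₃ * U₁ - 8 * S₁ * S₂ * S₃ * T₁ * T₂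
          - 4 * S₁ * S₂ * S₃ * U₃ + 2 * S₁ * S₃ ^ 2 * T₁ ^ 2 - 6 * S₁ * S₃ ^ 2 * U₂ + 8 * S₁ * S₃ * T₂ * T₃ - 4 * S₂ ^ 2 * S₃ * U₂ - 12 * S₂ * S₃ ^ 2 * U₁
          + 8 * S₂ * S₃ * T₁ * T₃ + 4 * S₂ * S₃ * T₂ ^ 2 + 9 * S₃ ^ 2 * U₃ - 9 * S₃ * T₃ ^ 2) := by
  ring

set_option maxHeartbeats 4000000 in
/-- `R₂(t)` as the value of the polynomial `R₂ ∈ ℝ[X]` (weight `7`). [folklore] -/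
theorem eval_R2 (σ₁ σ₂ σ₃ : ℝ[X]) (t : ℝ) :
    (σ₁ ^ 6 * (X * derivative (X * derivative σ₁)) - σ₁ ^ 5 * (X * derivative σ₁) ^ 2 - σ₁ ^ 5 * (X * derivative (X * derivative σ₂)) - 7 * σ₁ ^ 4 * σ₂ * (X * derivative (X * derivative σ₁))
          + 4 * σ₁ ^ 4 * (X * derivative σ₁) * (X * derivative σ₂) + σ₁ ^ 4 * (X * derivative (X * derivative σ₃)) + 3 * σ₁ ^ 3 * σ₂ * (X * derivative σ₁) ^ 2
          + 6 * σ₁ ^ 3 * σ₂ * (X * derivative (X * derivative σ₂)) + 8 * σ₁ ^ 3 * σ₃ * (X * derivative (X * derivative σ₁)) - 6 * σ₁ ^ 3 * (X * derivative σ₁) * (X * derivative σ₃)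
          - 3 * σ₁ ^ 3 * (X * derivative σ₂) ^ 2 + 13 * σ₁ ^ 2 * σ₂ ^ 2 * (X * derivative (X * derivative σ₁)) - 12 * σ₁ ^ 2 * σ₂ * (X * derivative σ₁) * (X * derivative σ₂)
          - 5 * σ₁ ^ 2 * σ₂ * (X * derivative (X * derivative σ₃)) + σ₁ ^ 2 * σ₃ * (X * derivative σ₁) ^ 2 - 7 * σ₁ ^ 2 * σ₃ * (X * derivative (X * derivative σ₂))
          + 8 * σ₁ ^ 2 * (X * derivative σ₂) * (X * derivative σ₃) - σ₁ * σ₂ ^ 2 * (X * derivative σ₁) ^ 2 - 8 * σ₁ * σ₂ ^ 2 * (X * derivative (X * derivative σ₂))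
          - 22 * σ₁ * σ₂ * σ₃ * (X * derivative (X * derivative σ₁)) + 14 * σ₁ * σ₂ * (X * derivative σ₁) * (X * derivative σ₃) + 7 * σ₁ * σ₂ * (X * derivative σ₂) ^ 2
          + 4 * σ₁ * σ₃ * (X * derivative σ₁) * (X * derivative σ₂) + 6 * σ₁ * σ₃ * (X * derivative (X * derivative σ₃)) - 5 * σ₁ * (X * derivative σ₃) ^ 2
          - 4 * σ₂ ^ 3 * (X * derivative (X * derivative σ₁)) + 4 * σ₂ ^ 2 * (X * derivative σ₁) * (X * derivative σ₂) + 4 * σ₂ ^ 2 * (X * derivative (X * derivative σ₃))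
          - 3 * σ₂ * σ₃ * (X * derivative σ₁) ^ 2 + 12 * σ₂ * σ₃ * (X * derivative (X * derivative σ₂)) - 12 * σ₂ * (X * derivative σ₂) * (X * derivative σ₃)
          + 9 * σ₃ ^ 2 * (X * derivative (X * derivative σ₁)) - 6 * σ₃ * (X * derivative σ₁) * (X * derivative σ₃) - 3 * σ₃ * (X * derivative σ₂) ^ 2).eval t =
      σ₁.eval t ^ 6 * (t * (derivative σ₁).eval t + t ^ 2 * (derivative (derivative σ₁)).eval t) - σ₁.eval t ^ 5 * (t * (derivative σ₁).eval t) ^ 2 - σ₁.eval t ^ 5 * (t * (derivative σ₂).eval t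
          + t ^ 2 * (derivative (derivative σ₂)).eval t) - 7 * σ₁.eval t ^ 4 * σ₂.eval t * (t * (derivative σ₁).eval t + t ^ 2 * (derivative (derivative σ₁)).eval t)
          + 4 * σ₁.eval t ^ 4 * (t * (derivative σ₁).eval t) * (t * (derivative σ₂).eval t) + σ₁.eval t ^ 4 * (t * (derivative σ₃).eval t + t ^ 2 * (derivative (derivative σ₃)).eval t)
          + 3 * σ₁.eval t ^ 3 * σ₂.eval t * (t * (derivative σ₁).eval t) ^ 2 + 6 * σ₁.eval t ^ 3 * σ₂.eval t * (t * (derivative σ₂).eval t + t ^ 2 * (derivative (derivative σ₂)).eval t)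
          + 8 * σ₁.eval t ^ 3 * σ₃.eval t * (t * (derivative σ₁).eval t + t ^ 2 * (derivative (derivative σ₁)).eval t) - 6 * σ₁.eval t ^ 3 * (t * (derivative σ₁).eval t) * (t * (derivative σ₃).eval t)
          - 3 * σ₁.eval t ^ 3 * (t * (derivative σ₂).eval t) ^ 2 + 13 * σ₁.eval t ^ 2 * σ₂.eval t ^ 2 * (t * (derivative σ₁).eval t + t ^ 2 * (derivative (derivative σ₁)).eval t)
          - 12 * σ₁.eval t ^ 2 * σ₂.eval t * (t * (derivative σ₁).eval t) * (t * (derivative σ₂).eval t) - 5 * σ₁.eval t ^ 2 * σ₂.eval t * (t * (derivative σ₃).eval t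
          + t ^ 2 * (derivative (derivative σ₃)).eval t) + σ₁.eval t ^ 2 * σ₃.eval t * (t * (derivative σ₁).eval t) ^ 2 - 7 * σ₁.eval t ^ 2 * σ₃.eval t * (t * (derivative σ₂).eval t
          + t ^ 2 * (derivative (derivative σ₂)).eval t) + 8 * σ₁.eval t ^ 2 * (t * (derivative σ₂).eval t) * (t * (derivative σ₃).eval t) - σ₁.eval t * σ₂.eval t ^ 2 * (t * (derivative σ₁).eval t) ^ 2
          - 8 * σ₁.eval t * σ₂.eval t ^ 2 * (t * (derivative σ₂).eval t + t ^ 2 * (derivative (derivative σ₂)).eval t) - 22 * σ₁.eval t * σ₂.eval t * σ₃.eval t * (t * (derivative σ₁).eval t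
          + t ^ 2 * (derivative (derivative σ₁)).eval t) + 14 * σ₁.eval t * σ₂.eval t * (t * (derivative σ₁).eval t) * (t * (derivative σ₃).eval t) + 7 * σ₁.eval t * σ₂.eval t * (t * (derivative σ₂).eval t) ^ 2
          + 4 * σ₁.eval t * σ₃.eval t * (t * (derivative σ₁).eval t) * (t * (derivative σ₂).eval t) + 6 * σ₁.eval t * σ₃.eval t * (t * (derivative σ₃).eval t
          + t ^ 2 * (derivative (derivative σ₃)).eval t) - 5 * σ₁.eval t * (t * (derivative σ₃).eval t) ^ 2 - 4 * σ₂.eval t ^ 3 * (t * (derivative σ₁).eval t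
          + t ^ 2 * (derivative (derivative σ₁)).eval t) + 4 * σ₂.eval t ^ 2 * (t * (derivative σ₁).eval t) * (t * (derivative σ₂).eval t) + 4 * σ₂.eval t ^ 2 * (t * (derivative σ₃).eval t
          + t ^ 2 * (derivative (derivative σ₃)).eval t) - 3 * σ₂.eval t * σ₃.eval t * (t * (derivative σ₁).eval t) ^ 2 + 12 * σ₂.eval t * σ₃.eval t * (t * (derivative σ₂).eval t
          + t ^ 2 * (derivative (derivative σ₂)).eval t) - 12 * σ₂.eval t * (t * (derivative σ₂).eval t) * (t * (derivative σ₃).eval t) + 9 * σ₃.eval t ^ 2 * (t * (derivative σ₁).eval t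
          + t ^ 2 * (derivative (derivative σ₁)).eval t) - 6 * σ₃.eval t * (t * (derivative σ₁).eval t) * (t * (derivative σ₃).eval t) - 3 * σ₃.eval t * (t * (derivative σ₂).eval t) ^ 2 := by
  simp only [eval_add, eval_sub, eval_mul, eval_pow, eval_X, eval_ofNat, derivative_mul, derivative_X, one_mul]
  ring

set_option maxHeartbeats 4000000 in
/-- `R₁(t)` as the value of the polynomial `R₁ ∈ ℝ[X]` (weight `8`). [folklore] -/
theorem eval_R1 (σ₁ σ₂ σ₃ : ℝ[X]) (t : ℝ) :
    (σ₁ ^ 5 * σ₂ * (X * derivative (X * derivative σ₁)) - σ₁ ^ 4 * σ₂ * (X * derivative σ₁) ^ 2 - σ₁ ^ 4 * σ₂ * (X * derivative (X * derivative σ₂)) - σ₁ ^ 4 * σ₃ * (X * derivative (X * derivative σ₁))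
          - 6 * σ₁ ^ 3 * σ₂ ^ 2 * (X * derivative (X * derivative σ₁)) + 4 * σ₁ ^ 3 * σ₂ * (X * derivative σ₁) * (X * derivative σ₂) + σ₁ ^ 3 * σ₂ * (X * derivative (X * derivative σ₃))
          + σ₁ ^ 3 * σ₃ * (X * derivative σ₁) ^ 2 + σ₁ ^ 3 * σ₃ * (X * derivative (X * derivative σ₂)) + 2 * σ₁ ^ 2 * σ₂ ^ 2 * (X * derivative σ₁) ^ 2
          + 5 * σ₁ ^ 2 * σ₂ ^ 2 * (X * derivative (X * derivative σ₂)) + 12 * σ₁ ^ 2 * σ₂ * σ₃ * (X * derivative (X * derivative σ₁)) - 6 * σ₁ ^ 2 * σ₂ * (X * derivative σ₁) * (X * derivative σ₃)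
          - 3 * σ₁ ^ 2 * σ₂ * (X * derivative σ₂) ^ 2 - 4 * σ₁ ^ 2 * σ₃ * (X * derivative σ₁) * (X * derivative σ₂) - σ₁ ^ 2 * σ₃ * (X * derivative (X * derivative σ₃))
          + 8 * σ₁ * σ₂ ^ 3 * (X * derivative (X * derivative σ₁)) - 8 * σ₁ * σ₂ ^ 2 * (X * derivative σ₁) * (X * derivative σ₂) - 4 * σ₁ * σ₂ ^ 2 * (X * derivative (X * derivative σ₃))
          + σ₁ * σ₂ * σ₃ * (X * derivative σ₁) ^ 2 - 10 * σ₁ * σ₂ * σ₃ * (X * derivative (X * derivative σ₂)) + 8 * σ₁ * σ₂ * (X * derivative σ₂) * (X * derivative σ₃)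
          - 6 * σ₁ * σ₃ ^ 2 * (X * derivative (X * derivative σ₁)) + 6 * σ₁ * σ₃ * (X * derivative σ₁) * (X * derivative σ₃) + 3 * σ₁ * σ₃ * (X * derivative σ₂) ^ 2
          - 4 * σ₂ ^ 3 * (X * derivative (X * derivative σ₂)) - 16 * σ₂ ^ 2 * σ₃ * (X * derivative (X * derivative σ₁)) + 8 * σ₂ ^ 2 * (X * derivative σ₁) * (X * derivative σ₃)
          + 4 * σ₂ ^ 2 * (X * derivative σ₂) ^ 2 + 4 * σ₂ * σ₃ * (X * derivative σ₁) * (X * derivative σ₂) + 12 * σ₂ * σ₃ * (X * derivative (X * derivative σ₃))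
          - 8 * σ₂ * (X * derivative σ₃) ^ 2 - 3 * σ₃ ^ 2 * (X * derivative σ₁) ^ 2 + 9 * σ₃ ^ 2 * (X * derivative (X * derivative σ₂)) - 12 * σ₃ * (X * derivative σ₂) * (X * derivative σ₃)).eval t =
      σ₁.eval t ^ 5 * σ₂.eval t * (t * (derivative σ₁).eval t + t ^ 2 * (derivative (derivative σ₁)).eval t) - σ₁.eval t ^ 4 * σ₂.eval t * (t * (derivative σ₁).eval t) ^ 2
          - σ₁.eval t ^ 4 * σ₂.eval t * (t * (derivative σ₂).eval t + t ^ 2 * (derivative (derivative σ₂)).eval t) - σ₁.eval t ^ 4 * σ₃.eval t * (t * (derivative σ₁).eval t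
          + t ^ 2 * (derivative (derivative σ₁)).eval t) - 6 * σ₁.eval t ^ 3 * σ₂.eval t ^ 2 * (t * (derivative σ₁).eval t + t ^ 2 * (derivative (derivative σ₁)).eval t)
          + 4 * σ₁.eval t ^ 3 * σ₂.eval t * (t * (derivative σ₁).eval t) * (t * (derivative σ₂).eval t) + σ₁.eval t ^ 3 * σ₂.eval t * (t * (derivative σ₃).eval t
          + t ^ 2 * (derivative (derivative σ₃)).eval t) + σ₁.eval t ^ 3 * σ₃.eval t * (t * (derivative σ₁).eval t) ^ 2 + σ₁.eval t ^ 3 * σ₃.eval t * (t * (derivative σ₂).eval t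
          + t ^ 2 * (derivative (derivative σ₂)).eval t) + 2 * σ₁.eval t ^ 2 * σ₂.eval t ^ 2 * (t * (derivative σ₁).eval t) ^ 2 + 5 * σ₁.eval t ^ 2 * σ₂.eval t ^ 2 * (t * (derivative σ₂).eval t
          + t ^ 2 * (derivative (derivative σ₂)).eval t) + 12 * σ₁.eval t ^ 2 * σ₂.eval t * σ₃.eval t * (t * (derivative σ₁).eval t + t ^ 2 * (derivative (derivative σ₁)).eval t)
          - 6 * σ₁.eval t ^ 2 * σ₂.eval t * (t * (derivative σ₁).eval t) * (t * (derivative σ₃).eval t) - 3 * σ₁.eval t ^ 2 * σ₂.eval t * (t * (derivative σ₂).eval t) ^ 2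
          - 4 * σ₁.eval t ^ 2 * σ₃.eval t * (t * (derivative σ₁).eval t) * (t * (derivative σ₂).eval t) - σ₁.eval t ^ 2 * σ₃.eval t * (t * (derivative σ₃).eval t
          + t ^ 2 * (derivative (derivative σ₃)).eval t) + 8 * σ₁.eval t * σ₂.eval t ^ 3 * (t * (derivative σ₁).eval t + t ^ 2 * (derivative (derivative σ₁)).eval t)
          - 8 * σ₁.eval t * σ₂.eval t ^ 2 * (t * (derivative σ₁).eval t) * (t * (derivative σ₂).eval t) - 4 * σ₁.eval t * σ₂.eval t ^ 2 * (t * (derivative σ₃).eval t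
          + t ^ 2 * (derivative (derivative σ₃)).eval t) + σ₁.eval t * σ₂.eval t * σ₃.eval t * (t * (derivative σ₁).eval t) ^ 2 - 10 * σ₁.eval t * σ₂.eval t * σ₃.eval t * (t * (derivative σ₂).eval t
          + t ^ 2 * (derivative (derivative σ₂)).eval t) + 8 * σ₁.eval t * σ₂.eval t * (t * (derivative σ₂).eval t) * (t * (derivative σ₃).eval t) - 6 * σ₁.eval t * σ₃.eval t ^ 2 * (t * (derivative σ₁).eval t
          + t ^ 2 * (derivative (derivative σ₁)).eval t) + 6 * σ₁.eval t * σ₃.eval t * (t * (derivative σ₁).eval t) * (t * (derivative σ₃).eval t) + 3 * σ₁.eval t * σ₃.eval t * (t * (derivative σ₂).eval t) ^ 2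
          - 4 * σ₂.eval t ^ 3 * (t * (derivative σ₂).eval t + t ^ 2 * (derivative (derivative σ₂)).eval t) - 16 * σ₂.eval t ^ 2 * σ₃.eval t * (t * (derivative σ₁).eval t
          + t ^ 2 * (derivative (derivative σ₁)).eval t) + 8 * σ₂.eval t ^ 2 * (t * (derivative σ₁).eval t) * (t * (derivative σ₃).eval t) + 4 * σ₂.eval t ^ 2 * (t * (derivative σ₂).eval t) ^ 2
          + 4 * σ₂.eval t * σ₃.eval t * (t * (derivative σ₁).eval t) * (t * (derivative σ₂).eval t) + 12 * σ₂.eval t * σ₃.eval t * (t * (derivative σ₃).eval t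
          + t ^ 2 * (derivative (derivative σ₃)).eval t) - 8 * σ₂.eval t * (t * (derivative σ₃).eval t) ^ 2 - 3 * σ₃.eval t ^ 2 * (t * (derivative σ₁).eval t) ^ 2
          + 9 * σ₃.eval t ^ 2 * (t * (derivative σ₂).eval t + t ^ 2 * (derivative (derivative σ₂)).eval t) - 12 * σ₃.eval t * (t * (derivative σ₂).eval t) * (t * (derivative σ₃).eval t) := by
  simp only [eval_add, eval_sub, eval_mul, eval_pow, eval_X, eval_ofNat, derivative_mul, derivative_X, one_mul]
  ring

set_option maxHeartbeats 4000000 in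
/-- `R₀(t)` as the value of the polynomial `R₀ ∈ ℝ[X]` (weight `9`). [folklore] -/
theorem eval_R0 (σ₁ σ₂ σ₃ : ℝ[X]) (t : ℝ) :
    (σ₁ ^ 5 * σ₃ * (X * derivative (X * derivative σ₁)) - σ₁ ^ 4 * σ₃ * (X * derivative σ₁) ^ 2 - σ₁ ^ 4 * σ₃ * (X * derivative (X * derivative σ₂)) - 6 * σ₁ ^ 3 * σ₂ * σ₃ * (X * derivative (X * derivative σ₁))
          + 4 * σ₁ ^ 3 * σ₃ * (X * derivative σ₁) * (X * derivative σ₂) + σ₁ ^ 3 * σ₃ * (X * derivative (X * derivative σ₃)) + 2 * σ₁ ^ 2 * σ₂ * σ₃ * (X * derivative σ₁) ^ 2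
          + 5 * σ₁ ^ 2 * σ₂ * σ₃ * (X * derivative (X * derivative σ₂)) + 7 * σ₁ ^ 2 * σ₃ ^ 2 * (X * derivative (X * derivative σ₁)) - 6 * σ₁ ^ 2 * σ₃ * (X * derivative σ₁) * (X * derivative σ₃)
          - 3 * σ₁ ^ 2 * σ₃ * (X * derivative σ₂) ^ 2 + 8 * σ₁ * σ₂ ^ 2 * σ₃ * (X * derivative (X * derivative σ₁)) - 8 * σ₁ * σ₂ * σ₃ * (X * derivative σ₁) * (X * derivative σ₂)
          - 4 * σ₁ * σ₂ * σ₃ * (X * derivative (X * derivative σ₃)) + 2 * σ₁ * σ₃ ^ 2 * (X * derivative σ₁) ^ 2 - 6 * σ₁ * σ₃ ^ 2 * (X * derivative (X * derivative σ₂))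
          + 8 * σ₁ * σ₃ * (X * derivative σ₂) * (X * derivative σ₃) - 4 * σ₂ ^ 2 * σ₃ * (X * derivative (X * derivative σ₂)) - 12 * σ₂ * σ₃ ^ 2 * (X * derivative (X * derivative σ₁))
          + 8 * σ₂ * σ₃ * (X * derivative σ₁) * (X * derivative σ₃) + 4 * σ₂ * σ₃ * (X * derivative σ₂) ^ 2 + 9 * σ₃ ^ 2 * (X * derivative (X * derivative σ₃))
          - 9 * σ₃ * (X * derivative σ₃) ^ 2).eval t =
      σ₁.eval t ^ 5 * σ₃.eval t * (t * (derivative σ₁).eval t + t ^ 2 * (derivative (derivative σ₁)).eval t) - σ₁.eval t ^ 4 * σ₃.eval t * (t * (derivative σ₁).eval t) ^ 2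
          - σ₁.eval t ^ 4 * σ₃.eval t * (t * (derivative σ₂).eval t + t ^ 2 * (derivative (derivative σ₂)).eval t) - 6 * σ₁.eval t ^ 3 * σ₂.eval t * σ₃.eval t * (t * (derivative σ₁).eval t
          + t ^ 2 * (derivative (derivative σ₁)).eval t) + 4 * σ₁.eval t ^ 3 * σ₃.eval t * (t * (derivative σ₁).eval t) * (t * (derivative σ₂).eval t)
          + σ₁.eval t ^ 3 * σ₃.eval t * (t * (derivative σ₃).eval t + t ^ 2 * (derivative (derivative σ₃)).eval t) + 2 * σ₁.eval t ^ 2 * σ₂.eval t * σ₃.eval t * (t * (derivative σ₁).eval t) ^ 2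
          + 5 * σ₁.eval t ^ 2 * σ₂.eval t * σ₃.eval t * (t * (derivative σ₂).eval t + t ^ 2 * (derivative (derivative σ₂)).eval t) + 7 * σ₁.eval t ^ 2 * σ₃.eval t ^ 2 * (t * (derivative σ₁).eval t
          + t ^ 2 * (derivative (derivative σ₁)).eval t) - 6 * σ₁.eval t ^ 2 * σ₃.eval t * (t * (derivative σ₁).eval t) * (t * (derivative σ₃).eval t)
          - 3 * σ₁.eval t ^ 2 * σ₃.eval t * (t * (derivative σ₂).eval t) ^ 2 + 8 * σ₁.eval t * σ₂.eval t ^ 2 * σ₃.eval t * (t * (derivative σ₁).eval t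
          + t ^ 2 * (derivative (derivative σ₁)).eval t) - 8 * σ₁.eval t * σ₂.eval t * σ₃.eval t * (t * (derivative σ₁).eval t) * (t * (derivative σ₂).eval t)
          - 4 * σ₁.eval t * σ₂.eval t * σ₃.eval t * (t * (derivative σ₃).eval t + t ^ 2 * (derivative (derivative σ₃)).eval t) + 2 * σ₁.eval t * σ₃.eval t ^ 2 * (t * (derivative σ₁).eval t) ^ 2
          - 6 * σ₁.eval t * σ₃.eval t ^ 2 * (t * (derivative σ₂).eval t + t ^ 2 * (derivative (derivative σ₂)).eval t) + 8 * σ₁.eval t * σ₃.eval t * (t * (derivative σ₂).eval t) * (t * (derivative σ₃).eval t)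
          - 4 * σ₂.eval t ^ 2 * σ₃.eval t * (t * (derivative σ₂).eval t + t ^ 2 * (derivative (derivative σ₂)).eval t) - 12 * σ₂.eval t * σ₃.eval t ^ 2 * (t * (derivative σ₁).eval t
          + t ^ 2 * (derivative (derivative σ₁)).eval t) + 8 * σ₂.eval t * σ₃.eval t * (t * (derivative σ₁).eval t) * (t * (derivative σ₃).eval t) + 4 * σ₂.eval t * σ₃.eval t * (t * (derivative σ₂).eval t) ^ 2
          + 9 * σ₃.eval t ^ 2 * (t * (derivative σ₃).eval t + t ^ 2 * (derivative (derivative σ₃)).eval t) - 9 * σ₃.eval t * (t * (derivative σ₃).eval t) ^ 2 := by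
  simp only [eval_add, eval_sub, eval_mul, eval_pow, eval_X, eval_ofNat, derivative_mul, derivative_X, one_mul]
  ring

set_option maxHeartbeats 4000000 in
/-- **The reduction on the curve**, with `R₂, R₁, R₀` as polynomials: if `b³ + b²σ₁(t) + bσ₂(t) + σ₃(t) = 0` then
`H(Φ)(t,b) = 0 ↔ R₂(t)·b² + R₁(t)·b + R₀(t) = 0`. [folklore] -/
theorem hess_reduce_poly3 (σ₁ σ₂ σ₃ : ℝ[X]) (t b : ℝ)
    (hΦ0 : b ^ 3 + b ^ 2 * σ₁.eval t + b * σ₂.eval t + σ₃.eval t = 0) :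
    (((t) * (derivative σ₁).eval (t) + (t) ^ 2 * (derivative (derivative σ₁)).eval (t)) * (b) ^ 2 + ((t) * (derivative σ₂).eval (t) + (t) ^ 2 * (derivative (derivative σ₂)).eval (t)) * (b)
          + ((t) * (derivative σ₃).eval (t) + (t) ^ 2 * (derivative (derivative σ₃)).eval (t))) * (3 * (b) ^ 3 + 2 * σ₁.eval (t) * (b) ^ 2 + σ₂.eval (t) * (b)) ^ 2
          - 2 * (2 * ((t) * (derivative σ₁).eval (t)) * (b) ^ 2 + ((t) * (derivative σ₂).eval (t)) * (b)) * (((t) * (derivative σ₁).eval (t)) * (b) ^ 2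
          + ((t) * (derivative σ₂).eval (t)) * (b) + ((t) * (derivative σ₃).eval (t))) * (3 * (b) ^ 3 + 2 * σ₁.eval (t) * (b) ^ 2 + σ₂.eval (t) * (b))
          + (9 * (b) ^ 3 + 4 * σ₁.eval (t) * (b) ^ 2 + σ₂.eval (t) * (b)) * (((t) * (derivative σ₁).eval (t)) * (b) ^ 2 + ((t) * (derivative σ₂).eval (t)) * (b)
          + ((t) * (derivative σ₃).eval (t))) ^ 2 = 0 ↔
      (σ₁ ^ 6 * (X * derivative (X * derivative σ₁)) - σ₁ ^ 5 * (X * derivative σ₁) ^ 2 - σ₁ ^ 5 * (X * derivative (X * derivative σ₂)) - 7 * σ₁ ^ 4 * σ₂ * (X * derivative (X * derivative σ₁))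
          + 4 * σ₁ ^ 4 * (X * derivative σ₁) * (X * derivative σ₂) + σ₁ ^ 4 * (X * derivative (X * derivative σ₃)) + 3 * σ₁ ^ 3 * σ₂ * (X * derivative σ₁) ^ 2
          + 6 * σ₁ ^ 3 * σ₂ * (X * derivative (X * derivative σ₂)) + 8 * σ₁ ^ 3 * σ₃ * (X * derivative (X * derivative σ₁)) - 6 * σ₁ ^ 3 * (X * derivative σ₁) * (X * derivative σ₃)
          - 3 * σ₁ ^ 3 * (X * derivative σ₂) ^ 2 + 13 * σ₁ ^ 2 * σ₂ ^ 2 * (X * derivative (X * derivative σ₁)) - 12 * σ₁ ^ 2 * σ₂ * (X * derivative σ₁) * (X * derivative σ₂)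
          - 5 * σ₁ ^ 2 * σ₂ * (X * derivative (X * derivative σ₃)) + σ₁ ^ 2 * σ₃ * (X * derivative σ₁) ^ 2 - 7 * σ₁ ^ 2 * σ₃ * (X * derivative (X * derivative σ₂))
          + 8 * σ₁ ^ 2 * (X * derivative σ₂) * (X * derivative σ₃) - σ₁ * σ₂ ^ 2 * (X * derivative σ₁) ^ 2 - 8 * σ₁ * σ₂ ^ 2 * (X * derivative (X * derivative σ₂))
          - 22 * σ₁ * σ₂ * σ₃ * (X * derivative (X * derivative σ₁)) + 14 * σ₁ * σ₂ * (X * derivative σ₁) * (X * derivative σ₃) + 7 * σ₁ * σ₂ * (X * derivative σ₂) ^ 2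
          + 4 * σ₁ * σ₃ * (X * derivative σ₁) * (X * derivative σ₂) + 6 * σ₁ * σ₃ * (X * derivative (X * derivative σ₃)) - 5 * σ₁ * (X * derivative σ₃) ^ 2
          - 4 * σ₂ ^ 3 * (X * derivative (X * derivative σ₁)) + 4 * σ₂ ^ 2 * (X * derivative σ₁) * (X * derivative σ₂) + 4 * σ₂ ^ 2 * (X * derivative (X * derivative σ₃))
          - 3 * σ₂ * σ₃ * (X * derivative σ₁) ^ 2 + 12 * σ₂ * σ₃ * (X * derivative (X * derivative σ₂)) - 12 * σ₂ * (X * derivative σ₂) * (X * derivative σ₃)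
          + 9 * σ₃ ^ 2 * (X * derivative (X * derivative σ₁)) - 6 * σ₃ * (X * derivative σ₁) * (X * derivative σ₃) - 3 * σ₃ * (X * derivative σ₂) ^ 2).eval t * b ^ 2 + (σ₁ ^ 5 * σ₂ * (X * derivative (X * derivative σ₁)) - σ₁ ^ 4 * σ₂ * (X * derivative σ₁) ^ 2 - σ₁ ^ 4 * σ₂ * (X * derivative (X * derivative σ₂)) - σ₁ ^ 4 * σ₃ * (X * derivative (X * derivative σ₁))
          - 6 * σ₁ ^ 3 * σ₂ ^ 2 * (X * derivative (X * derivative σ₁)) + 4 * σ₁ ^ 3 * σ₂ * (X * derivative σ₁) * (X * derivative σ₂) + σ₁ ^ 3 * σ₂ * (X * derivative (X * derivative σ₃))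
          + σ₁ ^ 3 * σ₃ * (X * derivative σ₁) ^ 2 + σ₁ ^ 3 * σ₃ * (X * derivative (X * derivative σ₂)) + 2 * σ₁ ^ 2 * σ₂ ^ 2 * (X * derivative σ₁) ^ 2
          + 5 * σ₁ ^ 2 * σ₂ ^ 2 * (X * derivative (X * derivative σ₂)) + 12 * σ₁ ^ 2 * σ₂ * σ₃ * (X * derivative (X * derivative σ₁)) - 6 * σ₁ ^ 2 * σ₂ * (X * derivative σ₁) * (X * derivative σ₃)
          - 3 * σ₁ ^ 2 * σ₂ * (X * derivative σ₂) ^ 2 - 4 * σ₁ ^ 2 * σ₃ * (X * derivative σ₁) * (X * derivative σ₂) - σ₁ ^ 2 * σ₃ * (X * derivative (X * derivative σ₃))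
          + 8 * σ₁ * σ₂ ^ 3 * (X * derivative (X * derivative σ₁)) - 8 * σ₁ * σ₂ ^ 2 * (X * derivative σ₁) * (X * derivative σ₂) - 4 * σ₁ * σ₂ ^ 2 * (X * derivative (X * derivative σ₃))
          + σ₁ * σ₂ * σ₃ * (X * derivative σ₁) ^ 2 - 10 * σ₁ * σ₂ * σ₃ * (X * derivative (X * derivative σ₂)) + 8 * σ₁ * σ₂ * (X * derivative σ₂) * (X * derivative σ₃)
          - 6 * σ₁ * σ₃ ^ 2 * (X * derivative (X * derivative σ₁)) + 6 * σ₁ * σ₃ * (X * derivative σ₁) * (X * derivative σ₃) + 3 * σ₁ * σ₃ * (X * derivative σ₂) ^ 2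
          - 4 * σ₂ ^ 3 * (X * derivative (X * derivative σ₂)) - 16 * σ₂ ^ 2 * σ₃ * (X * derivative (X * derivative σ₁)) + 8 * σ₂ ^ 2 * (X * derivative σ₁) * (X * derivative σ₃)
          + 4 * σ₂ ^ 2 * (X * derivative σ₂) ^ 2 + 4 * σ₂ * σ₃ * (X * derivative σ₁) * (X * derivative σ₂) + 12 * σ₂ * σ₃ * (X * derivative (X * derivative σ₃))
          - 8 * σ₂ * (X * derivative σ₃) ^ 2 - 3 * σ₃ ^ 2 * (X * derivative σ₁) ^ 2 + 9 * σ₃ ^ 2 * (X * derivative (X * derivative σ₂)) - 12 * σ₃ * (X * derivative σ₂) * (X * derivative σ₃)).eval t * b + (σ₁ ^ 5 * σ₃ * (X * derivative (X * derivative σ₁)) - σ₁ ^ 4 * σ₃ * (X * derivative σ₁) ^ 2 - σ₁ ^ 4 * σ₃ * (X * derivative (X * derivative σ₂)) - 6 * σ₁ ^ 3 * σ₂ * σ₃ * (X * derivative (X * derivative σ₁))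
          + 4 * σ₁ ^ 3 * σ₃ * (X * derivative σ₁) * (X * derivative σ₂) + σ₁ ^ 3 * σ₃ * (X * derivative (X * derivative σ₃)) + 2 * σ₁ ^ 2 * σ₂ * σ₃ * (X * derivative σ₁) ^ 2
          + 5 * σ₁ ^ 2 * σ₂ * σ₃ * (X * derivative (X * derivative σ₂)) + 7 * σ₁ ^ 2 * σ₃ ^ 2 * (X * derivative (X * derivative σ₁)) - 6 * σ₁ ^ 2 * σ₃ * (X * derivative σ₁) * (X * derivative σ₃)
          - 3 * σ₁ ^ 2 * σ₃ * (X * derivative σ₂) ^ 2 + 8 * σ₁ * σ₂ ^ 2 * σ₃ * (X * derivative (X * derivative σ₁)) - 8 * σ₁ * σ₂ * σ₃ * (X * derivative σ₁) * (X * derivative σ₂)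
          - 4 * σ₁ * σ₂ * σ₃ * (X * derivative (X * derivative σ₃)) + 2 * σ₁ * σ₃ ^ 2 * (X * derivative σ₁) ^ 2 - 6 * σ₁ * σ₃ ^ 2 * (X * derivative (X * derivative σ₂))
          + 8 * σ₁ * σ₃ * (X * derivative σ₂) * (X * derivative σ₃) - 4 * σ₂ ^ 2 * σ₃ * (X * derivative (X * derivative σ₂)) - 12 * σ₂ * σ₃ ^ 2 * (X * derivative (X * derivative σ₁))
          + 8 * σ₂ * σ₃ * (X * derivative σ₁) * (X * derivative σ₃) + 4 * σ₂ * σ₃ * (X * derivative σ₂) ^ 2 + 9 * σ₃ ^ 2 * (X * derivative (X * derivative σ₃))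
          - 9 * σ₃ * (X * derivative σ₃) ^ 2).eval t = 0 := by
  have hred := hess_reduce3 b (σ₁.eval t) (σ₂.eval t) (σ₃.eval t)
    (t * (derivative σ₁).eval t) (t * (derivative σ₂).eval t) (t * (derivative σ₃).eval t)
    (t * (derivative σ₁).eval t + t ^ 2 * (derivative (derivative σ₁)).eval t)
    (t * (derivative σ₂).eval t + t ^ 2 * (derivative (derivative σ₂)).eval t)
    (t * (derivative σ₃).eval t + t ^ 2 * (derivative (derivative σ₃)).eval t)
  rw [show b ^ 3 + σ₁.eval t * b ^ 2 + σ₂.eval t * b + σ₃.eval t = 0 by linarith, mul_zero, zero_add] at hred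
  rw [hred, eval_R2, eval_R1, eval_R0]

/-! ### The second Euclid step and the resultants -/

/-- **Second Euclid step**: `R₂²·Φ = (R₂ b + σ₁R₂ − R₁)·(R₂b² + R₁b + R₀) + (L₁ b + L₀)` with
`L₁ = σ₂R₂² − R₀R₂ − σ₁R₁R₂ + R₁²`, `L₀ = σ₃R₂² − σ₁R₀R₂ + R₀R₁` (generic identity, one `ring`). [folklore] -/
theorem euclid_step3 (b s₁ s₂ s₃ r₂ r₁ r₀ : ℝ) :
    r₂ ^ 2 * (b ^ 3 + b ^ 2 * s₁ + b * s₂ + s₃) =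
      (r₂ * b + (s₁ * r₂ - r₁)) * (r₂ * b ^ 2 + r₁ * b + r₀)
        + ((s₂ * r₂ ^ 2 - r₀ * r₂ - s₁ * r₁ * r₂ + r₁ ^ 2) * b + (s₃ * r₂ ^ 2 - s₁ * r₀ * r₂ + r₀ * r₁)) := by
  ring

/-- On the curve and the Hessian remainder: `L₁(t)·b + L₀(t) = 0`. [folklore] -/
theorem linear_step3 {b s₁ s₂ s₃ r₂ r₁ r₀ : ℝ} (hΦ : b ^ 3 + b ^ 2 * s₁ + b * s₂ + s₃ = 0)
    (hR : r₂ * b ^ 2 + r₁ * b + r₀ = 0) :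
    (s₂ * r₂ ^ 2 - r₀ * r₂ - s₁ * r₁ * r₂ + r₁ ^ 2) * b + (s₃ * r₂ ^ 2 - s₁ * r₀ * r₂ + r₀ * r₁) = 0 := by
  have h := euclid_step3 b s₁ s₂ s₃ r₂ r₁ r₀
  rw [hΦ, hR, mul_zero, mul_zero, zero_add] at h
  exact h.symm

/-- **Resultant step**: with `ℓ₁ b + ℓ₀ = 0`, `N := r₂ℓ₀² − r₁ℓ₀ℓ₁ + r₀ℓ₁² = ℓ₁²·(r₂b² + r₁b + r₀)`; so `N = 0` on the
osculation set. [folklore] -/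
theorem resultant_step3 {b r₂ r₁ r₀ ℓ₁ ℓ₀ : ℝ} (hL : ℓ₁ * b + ℓ₀ = 0) :
    r₂ * ℓ₀ ^ 2 - r₁ * ℓ₀ * ℓ₁ + r₀ * ℓ₁ ^ 2 = ℓ₁ ^ 2 * (r₂ * b ^ 2 + r₁ * b + r₀) := by
  have hℓ : ℓ₀ = -(ℓ₁ * b) := by linarith
  rw [hℓ]
  ring

/-- **Linear resultant step** (the regime `R₂ ≡ 0`): with `r₁ b + r₀ = 0`,
`N′ := s₃r₁³ − s₂r₀r₁² + s₁r₀²r₁ − r₀³ = r₁³·Φ(t,b)`. [folklore] -/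
theorem resultant_step3_lin {b s₁ s₂ s₃ r₁ r₀ : ℝ} (hR : r₁ * b + r₀ = 0) :
    s₃ * r₁ ^ 3 - s₂ * r₀ * r₁ ^ 2 + s₁ * r₀ ^ 2 * r₁ - r₀ ^ 3 = r₁ ^ 3 * (b ^ 3 + b ^ 2 * s₁ + b * s₂ + s₃) := by
  have hr : r₀ = -(r₁ * b) := by linarith
  rw [hr]
  ring

end OsculationCuspCubic

end Summit.ValiantsHypothesis.ValiantsHypothesis.Theorems.LacunarySymmetroidMatrixDescartes
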